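import Summits.QuantumFields.YangMills.Theorems.BalabanLadderUVSeamRecTorusCeiling
import Summits.QuantumFields.YangMills.Theorems.BalabanLadderIROddTorusChessboard
import HarnessLib

/-!
# Crux `UVSeamRec` (stmt-QuantumFields-20043): β-UNIFORM chessboard exponential moments of plaquette-cost sums on the odd
# four-torus (`SU(2)`, fundamental) — the volume-free and `β`-free Peierls currency of the measure side

Helper file (`--supports stmt-QuantumFields-20043`) of the LEAD seat `ym-spine-20043-p1` (gen 17).  Registered line `coldwall_pure`
(RESHAPE 2, skeleton sha `c86db84aa426ab4c`), second measure-side binder `stub_gaussianDomination : GaussianDominationSU2` — the extensive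
sub-Gaussian law of the classical carrier under Wilson's torus state.  This file supplies the tool for its FIXED-SCALE rungs (sequel
`…CarrierExpMomentFixedScale`): joint exponential moments of SUMS of plaquette costs at the Gaussian scale `c ≍ β`, uniformly in `β ≥ 2`
AND in the (odd) volume, extensive in the number of plaquettes.

WHAT (tree units `β = β_W/2`; `φ_q = 2 − Re tr U_q ∈ [0, 4]`; `M` odd, `M ≥ 3`; `β ≥ 2`).
* §1 `su2_torusLogPartition_sub_le` — the CHORD of the torus free energy WITHOUT THE LOG: for `0 ≤ c ≤ β/2`,
  `log Z_M(β − c) − log Z_M(β) ≤ 81 M⁴ + 6 M³ log β` (every `M ≥ 2`).  This is the inequality behind g11's torus thermal ceiling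
  `⟨φ⟩ ≤ 27/β + 2 log β/(Mβ)` (`ThermalFloor.wilsonExpectation_two_sub_trace_le_su2`, whose proof it re-traces: peeling upper bound at `β/2`,
  temporal-comb lower bound at `β` with Gaussian link balls `r = β^{-1/2}` — the `(3/2)·#dof·log β` terms cancel up to `6M³ log β`).
* §2 `su2_wilsonExpectation_expObs_le_orient` — the Fröhlich–Israel–Lieb–Simon chessboard estimate on the odd torus
  (`OddTorusChessboard.wilsonExpectation_expObs_le_exp_card`, IR desk) × §1: for every finite set `P` of plaquettes of ONE orientation and
  `0 ≤ c ≤ β/2`, `⟨exp(c Σ_{q∈P} φ_q)⟩_{Λ_M,β} ≤ exp(#P · (81 + 6 log β/M))`.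
* §3 `su2_wilsonExpectation_expObs_le` — ALL orientations, `0 ≤ c ≤ β/12`: the same bound (Jensen for `exp` over the six orientation
  classes, `exp(Σ_o y_o) ≤ (1/6)Σ_o exp(6y_o)`).
* §4 corollaries: on tori not smaller than `log β` the constant is `87` (`su2_wilsonExpectation_expObs_le_of_log_le`); the single plaquette
  at `c = β/2`: `⟨exp((β/2)φ_p)⟩_{Λ_M,β} ≤ exp(81 + 6 log β/M)` (`su2_wilsonExpectation_exp_half_mul_plaqCost_le`) — compare the tree's
  `WeakCouplingRates.su2_measureReal_plaqCost_ge_le_odd` (tail `C·β^κ·e^{−βs/2}`, power `κ` from crude link balls): here NO power of `β`.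

WHY (bears on 20043).  The carrier of (GD) is `Q = βR⁴·classicalResponse/C`, and `classicalResponse ≤ m₀(η) ≤ S_cube(U)` (the torus
configuration extends its own exterior); so at FIXED `R` the joint exponential moments (EM_Q) of separated carriers are joint exponential
moments of plaquette-cost sums at `c = β/12·(…)` — exactly §3, extensive and `β`-uniform.  The `R`-uniform statement (GD proper) needs the
incoherence of the boundary data (Gaussian averaging), which no chessboard bound sees; that is the open content of the stub.

HONEST FRAMING: reflection positivity + two explicit Laplace bounds of the torus partition function; a large-field/Peierls CURRENCY,
nothing of E0′, NT or the gap; YM mass gap NOT proved; not Clay.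

References: Fröhlich–Israel–Lieb–Simon, CMP 62 (1978) Thm. 4.1; Osterwalder–Seiler, Ann. Phys. 110 (1978) §2; Seiler, LNP 159 (1982) Ch. 4.
-/

open MeasureTheory Finset
open scoped Matrix.Norms.Frobenius
open Literature.MathematicalPhysics.QuantumFieldTheory
open Literature.MathematicalPhysics.QuantumLattice (fundamentalRep fundamentalRep_mem_unitaryGroup continuous_fundamentalRep
  secondCountableTopology_su2 torusLogPartition)
open Summit.QuantumFields.BalabanUV.InfraRed.StrongCouplingForestGauge (IsRankedForest)
open Summit.QuantumFields.YangMills.Theorems.SoloBlind (expObs plaquetteCost plaquetteCost_nonneg torusLogPartition_sub_nonneg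
  exists_abs_expObs_le measurable_expObs)
open Summit.QuantumFields.YangMills.Theorems.OddTorusChessboard (wilsonExpectation_expObs_le_exp_card)
open Summit.QuantumFields.YangMills.Cruxes.UVSeamRec.ClassicalResponse.ThermalFloor

noncomputable section

namespace Summit.QuantumFields.YangMills.Cruxes.UVSeamRec.Chessboard

/-! ### §1 The chord of the torus free energy without the log -/

/-- `log 600 ≤ 13/2`. [folklore] -/
private theorem log_600_le_aux : Real.log 600 ≤ 13 / 2 := by
  rw [Real.log_le_iff_le_exp (by norm_num)]
  have he : (2.71828 : ℝ) < Real.exp 1 := lt_trans (by norm_num) Real.exp_one_gt_d9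
  have h6 : Real.exp (13 / 2) = Real.exp 1 ^ 6 * Real.exp (1 / 2) := by
    rw [← Real.exp_nat_mul, ← Real.exp_add]; norm_num
  have h25 : (1 : ℝ) + 1 / 2 ≤ Real.exp (1 / 2) := by
    have := Real.add_one_le_exp (1 / 2 : ℝ); linarith
  have hp : (2.71828 : ℝ) ^ 6 < Real.exp 1 ^ 6 := by gcongr
  have h403 : (403 : ℝ) < Real.exp 1 ^ 6 := lt_trans (by norm_num) hp
  rw [h6]
  nlinarith [Real.exp_pos (1 / 2 : ℝ), h403, h25]

/-- `log 3 ≤ 7/5`. [folklore] -/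
private theorem log_three_le_aux : Real.log 3 ≤ 7 / 5 := by
  have h1 : Real.log 3 ≤ Real.log 4 := Real.log_le_log (by norm_num) (by norm_num)
  have h2 : Real.log 4 = 2 * Real.log 2 := by
    rw [show (4 : ℝ) = 2 ^ 2 by norm_num, Real.log_pow]; norm_num
  linarith [Real.log_two_lt_d9]

/-- **The chord `[β/2, β]` of the torus free energy, without the log (`SU(2)`, every volume).**  For `β ≥ 2` and every four-torus
`(ℤ/M)⁴`, `M ≥ 2`: `log Z_M(β/2) − log Z_M(β) ≤ 81 M⁴ + 6 M³ log β` — the peeling upper bound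
`log Z(β/2) ≤ 3(M⁴ − M³) log(3 (β/2)^{−3/2})` (`integral_exp_neg_mul_wilsonAction_le_su2`) against the temporal-comb lower bound
`log Z(β) ≥ −48M⁴ + (3M⁴ + M³) log(β^{−3/2}/600)` (`integral_exp_neg_mul_wilsonAction_ge_frozen`, Gaussian link balls); the `log β` terms
cancel up to `6M³ log β`.  (The two halves of g11's `wilsonExpectation_two_sub_trace_le_su2`, recorded as a free-energy statement.) [folklore] -/
theorem su2_torusLogPartition_half_sub_le {M : ℕ} [NeZero M] [Fact (1 < M)] {β : ℝ} (hβ : 2 ≤ β) :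
    torusLogPartition 4 (fundamentalRep (Fin 2)) (β / 2) M -
        torusLogPartition 4 (G := Matrix.specialUnitaryGroup (Fin 2) ℂ) (fundamentalRep (Fin 2)) β M ≤
      81 * (M : ℝ) ^ 4 + 6 * (M : ℝ) ^ 3 * Real.log β := by
  haveI : SecondCountableTopology (Matrix.specialUnitaryGroup (Fin 2) ℂ) := secondCountableTopology_su2
  set ρ := fundamentalRep (Fin 2) with hρdef
  have hρ : Continuous ρ := continuous_fundamentalRep (Fin 2)
  have hρU : ∀ g, ρ g ∈ Matrix.unitaryGroup (Fin 2) ℂ := fundamentalRep_mem_unitaryGroup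
  have hβ0 : 0 < β := by linarith
  have hβ1 : 1 ≤ β := by linarith
  have hlogβ : 0 ≤ Real.log β := Real.log_nonneg hβ1
  set Mr : ℝ := (M : ℝ) with hMr
  have hM1 : (2 : ℝ) ≤ Mr := by rw [hMr]; exact_mod_cast (Fact.out : 1 < M)
  have hM0 : 0 < Mr := by linarith
  -- the partition integrals
  set ZI : ℝ → ℝ := fun b => ∫ U, Real.exp (-b * wilsonAction ρ U)
    ∂(Measure.pi fun _ : Edge 4 M => haarProbability (Matrix.specialUnitaryGroup (Fin 2) ℂ)) with hZI
  have hZpos : ∀ b, 0 < ZI b := fun b => integral_exp_neg_mul_wilsonAction_pos ρ hρ b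
  rw [torusLogPartition_eq_log_integral ρ hρ, torusLogPartition_eq_log_integral ρ hρ]
  change Real.log (ZI (β / 2)) - Real.log (ZI β) ≤ _
  -- UPPER bound at `β/2`
  have hb : 0 < β / 2 := by linarith
  have hup0 := integral_exp_neg_mul_wilsonAction_le_su2 (M := M) hb
  have hcnt : ((M ^ 4 - M ^ 3 : ℕ) : ℝ) = Mr ^ 4 - Mr ^ 3 := by
    have hle : M ^ 3 ≤ M ^ 4 := Nat.pow_le_pow_right (NeZero.pos M) (by norm_num)
    rw [Nat.cast_sub hle]; push_cast; rw [hMr]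
  have hψpos : 0 < 3 / (β / 2 * Real.sqrt (β / 2)) := by positivity
  have hup : Real.log (ZI (β / 2)) ≤ 3 * (Mr ^ 4 - Mr ^ 3) * (Real.log 3 - 3 / 2 * Real.log (β / 2)) := by
    have h1 : Real.log (ZI (β / 2)) ≤ Real.log ((3 / (β / 2 * Real.sqrt (β / 2))) ^ (3 * (M ^ 4 - M ^ 3))) :=
      Real.log_le_log (hZpos _) hup0
    rw [Real.log_pow] at h1
    have h2 : Real.log (3 / (β / 2 * Real.sqrt (β / 2))) = Real.log 3 - 3 / 2 * Real.log (β / 2) := by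
      rw [Real.log_div (by norm_num) (by positivity), Real.log_mul hb.ne' (Real.sqrt_pos.2 hb).ne', Real.log_sqrt hb.le]
      ring
    rw [h2] at h1
    have h3 : ((3 * (M ^ 4 - M ^ 3) : ℕ) : ℝ) = 3 * (Mr ^ 4 - Mr ^ 3) := by push_cast [Nat.cast_mul]; rw [hcnt]
    rw [h3] at h1
    exact h1
  -- LOWER bound at `β` in the temporal-comb gauge with `r = β^{-1/2}`
  set r : ℝ := Real.sqrt (1 / β) with hr
  have hr0 : 0 < r := Real.sqrt_pos.2 (by positivity)
  have hr2 : r ^ 2 = 1 / β := by rw [hr, Real.sq_sqrt (by positivity)]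
  have hr1 : r ≤ 1 := by
    rw [hr, Real.sqrt_le_left zero_le_one, one_pow, div_le_one hβ0]; exact hβ1
  have hφ := haarProbability_real_frobeniusBall_ge_su2_sharp hr0 hr1
  have hlow0 := integral_exp_neg_mul_wilsonAction_ge_frozen (d := 4) (L := M) ρ hρ hρU (isRankedForest_temporalComb (M := M)) hβ0.le hr0
  rw [card_temporalComb, card_edge_four, card_plaquette_four] at hlow0
  have hfree : 4 * M ^ 4 - (M ^ 4 - M ^ 3) = 3 * M ^ 4 + M ^ 3 := by
    have hle : M ^ 3 ≤ M ^ 4 := Nat.pow_le_pow_right (NeZero.pos M) (by norm_num)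
    omega
  rw [hfree] at hlow0
  set φ : ℝ := (haarProbability (Matrix.specialUnitaryGroup (Fin 2) ℂ)).real
    {g : Matrix.specialUnitaryGroup (Fin 2) ℂ | ‖ρ g - 1‖ ≤ r} with hφdef
  have hφpos : 0 < φ := lt_of_lt_of_le (by positivity) hφ
  have hlow : -(48 * Mr ^ 4) + (3 * Mr ^ 4 + Mr ^ 3) * (3 * Real.log r - Real.log 600) ≤ Real.log (ZI β) := by
    have h1 : Real.log (Real.exp (-(8 * β * r ^ 2 * ((6 * M ^ 4 : ℕ) : ℝ))) * φ ^ (3 * M ^ 4 + M ^ 3)) ≤ Real.log (ZI β) :=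
      Real.log_le_log (mul_pos (Real.exp_pos _) (pow_pos hφpos _)) hlow0
    rw [Real.log_mul (Real.exp_pos _).ne' (pow_pos hφpos _).ne', Real.log_exp, Real.log_pow] at h1
    have h2 : 8 * β * r ^ 2 * ((6 * M ^ 4 : ℕ) : ℝ) = 48 * Mr ^ 4 := by
      rw [hr2]; push_cast; rw [hMr]; field_simp; ring
    rw [h2] at h1
    have h3 : 3 * Real.log r - Real.log 600 ≤ Real.log φ := by
      have := Real.log_le_log (by positivity) hφ
      rwa [Real.log_div (by positivity) (by norm_num), Real.log_pow] at this
    have h4 : ((3 * M ^ 4 + M ^ 3 : ℕ) : ℝ) = 3 * Mr ^ 4 + Mr ^ 3 := by push_cast; rw [hMr]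
    rw [h4] at h1
    have h5 : (3 * Mr ^ 4 + Mr ^ 3) * (3 * Real.log r - Real.log 600) ≤ (3 * Mr ^ 4 + Mr ^ 3) * Real.log φ :=
      mul_le_mul_of_nonneg_left h3 (by positivity)
    linarith
  -- logarithms of `r` and `β/2`
  have hlogr : Real.log r = -(Real.log β) / 2 := by
    rw [hr, Real.log_sqrt (by positivity), one_div, Real.log_inv]
  have hlog2 : Real.log (β / 2) = Real.log β - Real.log 2 := Real.log_div hβ0.ne' (by norm_num)
  -- the difference of the two Laplace bounds, expanded
  have hsum : Real.log (ZI (β / 2)) - Real.log (ZI β) ≤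
      3 * (Mr ^ 4 - Mr ^ 3) * (Real.log 3 - 3 / 2 * Real.log (β / 2)) -
        (-(48 * Mr ^ 4) + (3 * Mr ^ 4 + Mr ^ 3) * (3 * Real.log r - Real.log 600)) := by linarith
  have hexp : 3 * (Mr ^ 4 - Mr ^ 3) * (Real.log 3 - 3 / 2 * Real.log (β / 2)) -
        (-(48 * Mr ^ 4) + (3 * Mr ^ 4 + Mr ^ 3) * (3 * Real.log r - Real.log 600)) =
      6 * Mr ^ 3 * Real.log β + (3 * (Mr ^ 4 - Mr ^ 3) * (Real.log 3 + 3 / 2 * Real.log 2) + 48 * Mr ^ 4 +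
        (3 * Mr ^ 4 + Mr ^ 3) * Real.log 600) := by
    rw [hlog2, hlogr]; ring
  -- numerical bounds: `log 3 + (3/2) log 2 ≤ 61/25`, `log 600 ≤ 13/2`, `M³ ≤ M⁴/2`
  have hl2 := Real.log_two_lt_d9
  have hl2' : 0 < Real.log 2 := Real.log_pos (by norm_num)
  have hl3' : 0 ≤ Real.log 3 := Real.log_nonneg (by norm_num)
  have hM3 : 2 * Mr ^ 3 ≤ Mr ^ 4 := by
    have h := mul_le_mul_of_nonneg_right hM1 (pow_pos hM0 3).le
    rwa [show Mr * Mr ^ 3 = Mr ^ 4 by ring] at h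
  have hA : 3 * (Mr ^ 4 - Mr ^ 3) * (Real.log 3 + 3 / 2 * Real.log 2) ≤ 3 * (Mr ^ 4 * (61 / 25)) := by
    have h2 : Real.log 3 + 3 / 2 * Real.log 2 ≤ 61 / 25 := by linarith [log_three_le_aux]
    have h3 : 0 ≤ Real.log 3 + 3 / 2 * Real.log 2 := by linarith
    have h4 : Mr ^ 4 - Mr ^ 3 ≤ Mr ^ 4 := by linarith [pow_pos hM0 3]
    have h5 := mul_le_mul h4 h2 h3 (pow_pos hM0 4).le
    have h6 : 3 * (Mr ^ 4 - Mr ^ 3) * (Real.log 3 + 3 / 2 * Real.log 2) =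
        3 * ((Mr ^ 4 - Mr ^ 3) * (Real.log 3 + 3 / 2 * Real.log 2)) := by ring
    rw [h6]
    linarith [h5]
  have hB : (3 * Mr ^ 4 + Mr ^ 3) * Real.log 600 ≤ 7 / 2 * Mr ^ 4 * (13 / 2) := by
    have h2 : 3 * Mr ^ 4 + Mr ^ 3 ≤ 7 / 2 * Mr ^ 4 := by linarith [hM3]
    have h3 : 0 ≤ Real.log 600 := Real.log_nonneg (by norm_num)
    exact mul_le_mul h2 log_600_le_aux h3 (by positivity)
  rw [hexp] at hsum
  have hM4 : 0 ≤ Mr ^ 4 := (pow_pos hM0 4).le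
  rw [hMr] at hsum hA hB hM4
  linarith [hsum, hA, hB, hM4]

/-- **The chord at any `c ≤ β/2`.**  For `β ≥ 2`, `0 ≤ c ≤ β/2` and every `M ≥ 2`: `log Z_M(β − c) − log Z_M(β) ≤ 81 M⁴ + 6 M³ log β`
(`log Z` is non-increasing: `SoloBlind.torusLogPartition_sub_nonneg`). [folklore] -/
theorem su2_torusLogPartition_sub_le {M : ℕ} [NeZero M] [Fact (1 < M)] {β : ℝ} (hβ : 2 ≤ β) {c : ℝ}
    (hcβ : c ≤ β / 2) :
    torusLogPartition 4 (fundamentalRep (Fin 2)) (β - c) M -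
        torusLogPartition 4 (G := Matrix.specialUnitaryGroup (Fin 2) ℂ) (fundamentalRep (Fin 2)) β M ≤
      81 * (M : ℝ) ^ 4 + 6 * (M : ℝ) ^ 3 * Real.log β := by
  have hmono := torusLogPartition_sub_nonneg (d := 4) (L := M) (G := Matrix.specialUnitaryGroup (Fin 2) ℂ)
    (fundamentalRep (Fin 2)) (continuous_fundamentalRep (Fin 2)) (β := β - c) (c := β - c - β / 2) (by linarith)
  rw [show β - c - (β - c - β / 2) = β / 2 by ring] at hmono
  linarith [su2_torusLogPartition_half_sub_le (M := M) hβ]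

/-! ### §2 The chessboard estimate, one orientation -/

/-- **β-UNIFORM CHESSBOARD EXPONENTIAL MOMENT, one orientation.**  `SU(2)` fundamental, `M` odd, `M ≥ 3`, `β ≥ 2`, `0 ≤ c ≤ β/2`; for every
finite set `P` of plaquettes of one orientation `o`:
`⟨exp(c Σ_{q∈P} φ_q)⟩_{Λ_M,β} ≤ exp(#P · (81 + 6 log β/M))` — FILS chessboard on the odd torus (IR desk) × the log-free chord (§1).
Extensive in `#P`, uniform in the volume, and uniform in `β` on tori `M ≥ log β`. [folklore] -/
theorem su2_wilsonExpectation_expObs_le_orient {M : ℕ} [NeZero M] (hM : Odd M) (hM3 : 3 ≤ M) {β c : ℝ} (hβ : 2 ≤ β)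
    (hc : 0 ≤ c) (hcβ : c ≤ β / 2) (o : {p : Fin 4 × Fin 4 // p.1 < p.2}) (P : Finset (Plaquette 4 M))
    (hP : ∀ q ∈ P, q.2 = o) :
    wilsonExpectation (fundamentalRep (Fin 2)) β (expObs (G := Matrix.specialUnitaryGroup (Fin 2) ℂ) (fundamentalRep (Fin 2)) c P) ≤
      Real.exp (#P * (81 + 6 * Real.log β / M)) := by
  haveI : Fact (1 < M) := ⟨by omega⟩
  have hM0 : (0 : ℝ) < M := by exact_mod_cast (show 0 < M by omega)
  have h1 := wilsonExpectation_expObs_le_exp_card (d := 4) (L := M) (G := Matrix.specialUnitaryGroup (Fin 2) ℂ)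
    (fundamentalRep (Fin 2)) hM hM3 (continuous_fundamentalRep (Fin 2)) (β := β) (c := c) hc (by linarith) o P hP
  refine h1.trans (Real.exp_le_exp.2 ?_)
  have h2 := su2_torusLogPartition_sub_le (M := M) hβ hcβ
  have h3 : (#P : ℝ) / (M : ℝ) ^ 4 * (81 * (M : ℝ) ^ 4 + 6 * (M : ℝ) ^ 3 * Real.log β) = #P * (81 + 6 * Real.log β / M) := by
    field_simp
  calc (#P : ℝ) / (M : ℝ) ^ 4 * (torusLogPartition 4 (fundamentalRep (Fin 2)) (β - c) M -
          torusLogPartition 4 (G := Matrix.specialUnitaryGroup (Fin 2) ℂ) (fundamentalRep (Fin 2)) β M)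
      ≤ (#P : ℝ) / (M : ℝ) ^ 4 * (81 * (M : ℝ) ^ 4 + 6 * (M : ℝ) ^ 3 * Real.log β) :=
        mul_le_mul_of_nonneg_left h2 (by positivity)
    _ = #P * (81 + 6 * Real.log β / M) := h3

/-! ### §3 All orientations -/

/-- Jensen for `exp` over a finite index type: `exp(Σ_i y_i) ≤ (1/n) Σ_i exp(n·y_i)`, `n = card ι ≥ 1`. [folklore] -/
theorem exp_sum_le_card_inv_mul_sum_exp {ι : Type*} [Fintype ι] [Nonempty ι] (y : ι → ℝ) :
    Real.exp (∑ i, y i) ≤ (Fintype.card ι : ℝ)⁻¹ * ∑ i, Real.exp (Fintype.card ι * y i) := by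
  have hn : (0 : ℝ) < Fintype.card ι := by exact_mod_cast Fintype.card_pos
  have h := (convexOn_exp).map_sum_le (t := (univ : Finset ι)) (w := fun _ => (Fintype.card ι : ℝ)⁻¹)
    (p := fun i => (Fintype.card ι : ℝ) * y i) (fun _ _ => by positivity)
    (by rw [sum_const, card_univ, nsmul_eq_mul, mul_inv_cancel₀ hn.ne']) (fun _ _ => Set.mem_univ _)
  have e1 : ∑ i, (Fintype.card ι : ℝ)⁻¹ • ((Fintype.card ι : ℝ) * y i) = ∑ i, y i := by
    refine sum_congr rfl fun i _ => ?_
    rw [smul_eq_mul, ← mul_assoc, inv_mul_cancel₀ hn.ne', one_mul]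
  rw [e1] at h
  refine h.trans (le_of_eq ?_)
  rw [mul_sum]
  refine sum_congr rfl fun i _ => ?_
  rw [smul_eq_mul]

/-- **β-UNIFORM CHESSBOARD EXPONENTIAL MOMENT, all orientations.**  `SU(2)` fundamental, `M` odd, `M ≥ 3`, `β ≥ 2`, `0 ≤ c ≤ β/12`; for
EVERY finite set `P` of plaquettes: `⟨exp(c Σ_{q∈P} φ_q)⟩_{Λ_M,β} ≤ exp(#P · (81 + 6 log β/M))`.  Jensen over the six orientation classes
(`exp(Σ_o y_o) ≤ (1/6)Σ_o exp(6 y_o)`) and §2 at `6c ≤ β/2` for each class. [folklore] -/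
theorem su2_wilsonExpectation_expObs_le {M : ℕ} [NeZero M] (hM : Odd M) (hM3 : 3 ≤ M) {β c : ℝ} (hβ : 2 ≤ β)
    (hc : 0 ≤ c) (hcβ : c ≤ β / 12) (P : Finset (Plaquette 4 M)) :
    wilsonExpectation (fundamentalRep (Fin 2)) β (expObs (G := Matrix.specialUnitaryGroup (Fin 2) ℂ) (fundamentalRep (Fin 2)) c P) ≤
      Real.exp (#P * (81 + 6 * Real.log β / M)) := by
  classical
  set ρ := fundamentalRep (Fin 2) with hρdef
  have hρ : Continuous ρ := continuous_fundamentalRep (Fin 2)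
  haveI := isProbabilityMeasure_wilsonMeasure (d := 4) (L := M) (G := Matrix.specialUnitaryGroup (Fin 2) ℂ) ρ hρ β
  haveI : Nonempty {p : Fin 4 × Fin 4 // p.1 < p.2} := ⟨⟨((0 : Fin 4), (1 : Fin 4)), by decide⟩⟩
  -- orientation classes
  set Pc : {p : Fin 4 × Fin 4 // p.1 < p.2} → Finset (Plaquette 4 M) := fun o => P.filter fun q => q.2 = o with hPc
  have hPc : ∀ o, ∀ q ∈ Pc o, q.2 = o := fun o q hq => (mem_filter.1 hq).2
  have hcard : ∀ o, #(Pc o) ≤ #P := fun o => card_filter_le _ _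
  have hM0 : (0 : ℝ) < M := by exact_mod_cast (show 0 < M by omega)
  have hK : 0 ≤ 81 + 6 * Real.log β / M := by
    have : 0 ≤ Real.log β := Real.log_nonneg (by linarith)
    positivity
  -- pointwise Jensen over the orientations
  have hpt : ∀ U : GaugeConfig 4 M (Matrix.specialUnitaryGroup (Fin 2) ℂ),
      expObs (G := Matrix.specialUnitaryGroup (Fin 2) ℂ) ρ c P U ≤
        ∑ o : {p : Fin 4 × Fin 4 // p.1 < p.2}, (6 : ℝ)⁻¹ * expObs ρ (6 * c) (Pc o) U := by
    intro U
    have hsplit : c * ∑ q ∈ P, plaquetteCost ρ q.1 q.2.1.1 q.2.1.2 U =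
        ∑ o : {p : Fin 4 × Fin 4 // p.1 < p.2}, c * ∑ q ∈ Pc o, plaquetteCost ρ q.1 q.2.1.1 q.2.1.2 U := by
      rw [← mul_sum]
      congr 1
      exact (sum_fiberwise_of_maps_to (s := P) (t := (univ : Finset {p : Fin 4 × Fin 4 // p.1 < p.2}))
        (g := fun q : Plaquette 4 M => q.2) (fun q _ => mem_univ _)
        (fun q : Plaquette 4 M => plaquetteCost ρ q.1 q.2.1.1 q.2.1.2 U)).symm
    unfold expObs
    rw [hsplit]
    refine (exp_sum_le_card_inv_mul_sum_exp _).trans (le_of_eq ?_)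
    rw [show Fintype.card {p : Fin 4 × Fin 4 // p.1 < p.2} = 6 by decide, mul_sum]
    refine sum_congr rfl fun o _ => ?_
    push_cast
    ring_nf
  -- integrate
  have hint : ∀ o : {p : Fin 4 × Fin 4 // p.1 < p.2}, Integrable (fun U => (6 : ℝ)⁻¹ * expObs (G := Matrix.specialUnitaryGroup (Fin 2) ℂ) ρ (6 * c) (Pc o) U)
      (wilsonMeasure (d := 4) (L := M) ρ β) := by
    intro o
    obtain ⟨C, hC⟩ := exists_abs_expObs_le (d := 4) (L := M) (G := Matrix.specialUnitaryGroup (Fin 2) ℂ) ρ hρ (6 * c) (Pc o)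
    exact (Integrable.of_bound (measurable_expObs ρ hρ (6 * c) (Pc o)).aestronglyMeasurable C
      (ae_of_all _ fun U => by rw [Real.norm_eq_abs]; exact hC U)).const_mul _
  have hintP : Integrable (expObs (G := Matrix.specialUnitaryGroup (Fin 2) ℂ) ρ c P) (wilsonMeasure (d := 4) (L := M) ρ β) := by
    obtain ⟨C, hC⟩ := exists_abs_expObs_le (d := 4) (L := M) (G := Matrix.specialUnitaryGroup (Fin 2) ℂ) ρ hρ c P
    exact Integrable.of_bound (measurable_expObs ρ hρ c P).aestronglyMeasurable C
      (ae_of_all _ fun U => by rw [Real.norm_eq_abs]; exact hC U)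
  have hstep : wilsonExpectation ρ β (expObs (G := Matrix.specialUnitaryGroup (Fin 2) ℂ) ρ c P) ≤
      ∑ o : {p : Fin 4 × Fin 4 // p.1 < p.2}, (6 : ℝ)⁻¹ * wilsonExpectation ρ β (expObs (G := Matrix.specialUnitaryGroup (Fin 2) ℂ) ρ (6 * c) (Pc o)) := by
    unfold wilsonExpectation
    calc ∫ U, expObs ρ c P U ∂(wilsonMeasure ρ β)
        ≤ ∫ U, ∑ o : {p : Fin 4 × Fin 4 // p.1 < p.2}, (6 : ℝ)⁻¹ * expObs ρ (6 * c) (Pc o) U ∂(wilsonMeasure ρ β) :=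
          integral_mono hintP (integrable_finsetSum _ fun o _ => hint o) hpt
      _ = ∑ o : {p : Fin 4 × Fin 4 // p.1 < p.2}, (6 : ℝ)⁻¹ * ∫ U, expObs ρ (6 * c) (Pc o) U ∂(wilsonMeasure ρ β) := by
          rw [integral_finsetSum _ fun o _ => hint o]
          refine sum_congr rfl fun o _ => ?_
          rw [integral_const_mul]
  refine hstep.trans ?_
  have hclass : ∀ o : {p : Fin 4 × Fin 4 // p.1 < p.2}, wilsonExpectation ρ β (expObs (G := Matrix.specialUnitaryGroup (Fin 2) ℂ) ρ (6 * c) (Pc o)) ≤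
      Real.exp (#P * (81 + 6 * Real.log β / M)) := by
    intro o
    refine (su2_wilsonExpectation_expObs_le_orient hM hM3 hβ (by positivity) (by linarith) o (Pc o) (hPc o)).trans ?_
    refine Real.exp_le_exp.2 (mul_le_mul_of_nonneg_right ?_ hK)
    exact_mod_cast hcard o
  calc ∑ o : {p : Fin 4 × Fin 4 // p.1 < p.2}, (6 : ℝ)⁻¹ * wilsonExpectation ρ β (expObs (G := Matrix.specialUnitaryGroup (Fin 2) ℂ) ρ (6 * c) (Pc o))
      ≤ ∑ _o : {p : Fin 4 × Fin 4 // p.1 < p.2}, (6 : ℝ)⁻¹ * Real.exp (#P * (81 + 6 * Real.log β / M)) :=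
        sum_le_sum fun o _ => mul_le_mul_of_nonneg_left (hclass o) (by norm_num)
    _ = Real.exp (#P * (81 + 6 * Real.log β / M)) := by
        rw [sum_const, card_univ, show Fintype.card {p : Fin 4 × Fin 4 // p.1 < p.2} = 6 by decide, nsmul_eq_mul]
        ring

/-! ### §4 Corollaries: tori not smaller than `log β`; one plaquette at `c = β/2` -/

/-- **On tori with `log β ≤ M`** the constant is numerical: `⟨exp(c Σ_{q∈P} φ_q)⟩_{Λ_M,β} ≤ exp(87 · #P)` for `0 ≤ c ≤ β/12`, every `P`.
[folklore] -/
theorem su2_wilsonExpectation_expObs_le_of_log_le {M : ℕ} [NeZero M] (hM : Odd M) (hM3 : 3 ≤ M) {β c : ℝ} (hβ : 2 ≤ β)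
    (hlog : Real.log β ≤ M) (hc : 0 ≤ c) (hcβ : c ≤ β / 12) (P : Finset (Plaquette 4 M)) :
    wilsonExpectation (fundamentalRep (Fin 2)) β (expObs (G := Matrix.specialUnitaryGroup (Fin 2) ℂ) (fundamentalRep (Fin 2)) c P) ≤
      Real.exp (87 * #P) := by
  refine (su2_wilsonExpectation_expObs_le hM hM3 hβ hc hcβ P).trans (Real.exp_le_exp.2 ?_)
  have hM0 : (0 : ℝ) < M := by exact_mod_cast (show 0 < M by omega)
  have h1 : 6 * Real.log β / M ≤ 6 := by
    rw [div_le_iff₀ hM0]; linarith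
  have h2 : (0 : ℝ) ≤ #P := Nat.cast_nonneg _
  nlinarith

/-- **β-uniform exponential moment of ONE plaquette at half the coupling.**  `M` odd `≥ 3`, `β ≥ 2`, every plaquette `p`:
`⟨exp((β/2)·φ_p)⟩_{Λ_M,β} ≤ exp(81 + 6 log β/M)` — no power of `β` (cf. `WeakCouplingRates.su2_measureReal_plaqCost_ge_le_odd`). [folklore] -/
theorem su2_wilsonExpectation_exp_half_mul_plaqCost_le {M : ℕ} [NeZero M] (hM : Odd M) (hM3 : 3 ≤ M) {β : ℝ} (hβ : 2 ≤ β)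
    (p : Plaquette 4 M) :
    wilsonExpectation (fundamentalRep (Fin 2)) β
        (fun U : GaugeConfig 4 M (Matrix.specialUnitaryGroup (Fin 2) ℂ) =>
          Real.exp (β / 2 * plaquetteCost (fundamentalRep (Fin 2)) p.1 p.2.1.1 p.2.1.2 U)) ≤
      Real.exp (81 + 6 * Real.log β / M) := by
  have h := su2_wilsonExpectation_expObs_le_orient hM hM3 hβ (c := β / 2) (by linarith) le_rfl p.2 {p}
    (fun q hq => by rw [mem_singleton.1 hq])
  have e : expObs (G := Matrix.specialUnitaryGroup (Fin 2) ℂ) (fundamentalRep (Fin 2)) (β / 2) {p} =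
      fun U => Real.exp (β / 2 * plaquetteCost (fundamentalRep (Fin 2)) p.1 p.2.1.1 p.2.1.2 U) := by
    funext U; simp [expObs]
  rw [e, card_singleton, Nat.cast_one, one_mul] at h
  exact h

end Summit.QuantumFields.YangMills.Cruxes.UVSeamRec.Chessboard

end
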